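import Summits.FinalStateConjecture.FinalStateConjecture.Theses.EIHFluxBalance
import Literature.Geometry.Lorentzian.MinkowskiGlobalHyperbolicity

/-!
# Route EIHFluxBalance — `InertialRecession`, re-charting: late points of the exterior region lie
# outside every painted horizon (first use of lab-time causality)

Helper file for the crux `stmt-FinalStateConjecture-10166`
(`Summit.FinalStateConjecture.FinalStateConjecture.Theses.EIHFluxBalance.InertialRecession`),
line `sublinear-is-free-clean-window-charges`, stub `stub_rechart` (the transfer P2, reshape r4).

The covering clauses of the sought `FinalStateDecomposition` are transported from the hypothesis'
LAB-SLAB exhaustion clause to the TILTED slabs of the hole charts along causal curves supplied by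
that clause; near the painted horizons this needs to know that such curves never visit points of
the lab image with painted radius `≤ r₊`. This file proves that fact (`F1` of the prover's route)
from the two causal clauses of the reshaped stub:

* EXHAUSTION at every lab time `t₁ > τ₀`: `O ∖ Φ(E(t₁)) ⊆ J⁻(Φ(S(t₁)))`, with `E(t₁)`/`S(t₁)` the
  painted exterior after/at lab time `t₁`;
* LAB-TIME CAUSALITY after `τ₁` (`H_time′`): for lab points `x, y` later than `τ₁`,
  `Φ y ∈ J⁺(Φ x) ⟹ x⁰ ≤ y⁰`.

`painted_exterior_of_mem_exterior'` (registered one-line form unprimed): a point `Φ x` of `O` with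
`x⁰ > max τ₀ τ₁` has painted radius `> r₊ᵢ` for EVERY hole `i`. Proof: otherwise `x ∉ E(t′)` for
any `t′`, so for `t′ ∈ (max τ₀ τ₁, x⁰)` exhaustion puts `Φ x` in the causal past of a point `Φ y`
of the lab slab `{y⁰ = t′}`; time duality (`mem_causalPast_singleton_iff`) makes `Φ y ∈ J⁺(Φ x)`,
and lab-time causality gives `x⁰ ≤ t′ < x⁰`. Consequence (`exterior_inter_image_subset`): the part
of `O` charted after `max τ₀ τ₁` IS the late painted exterior — the painted horizons bound `O` in
the lab chart exactly, which is why hole charts whose `{r = r₊}` is the painted horizon inherit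
horizon normalisation. [folklore causal bookkeeping]
-/

noncomputable section

set_option linter.dupNamespace false

open Set Filter Function Topology TopologicalSpace Literature.Geometry.Lorentzian
open scoped Manifold

namespace Summit.FinalStateConjecture.FinalStateConjecture.Theorems.SublinearIsFree.Rechart

/-- An open embedding of the late region is injective on it (as a statement about points of the
whole chart domain). [folklore] -/
theorem injOn_late_of_isOpenEmbedding {Y : Type*} [TopologicalSpace Y] {U : Opens E4} {τ₀ : ℝ}
    {Φ : U → Y} (hemb : Topology.IsOpenEmbedding (({x : U | τ₀ < x.1 0} : Set U).restrict Φ)) :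
    InjOn Φ {x : U | τ₀ < x.1 0} := by
  intro x hx y hy hxy
  have h := hemb.injective (a₁ := ⟨x, hx⟩) (a₂ := ⟨y, hy⟩) hxy
  exact congrArg Subtype.val h

/-- `J⁻(S)` is the union of the `J⁻` of the points of `S`. [folklore] -/
theorem mem_causalPast_iff_exists {E : Type*} [NormedAddCommGroup E] [NormedSpace ℝ E]
    {H : Type*} [TopologicalSpace H] {I : ModelWithCorners ℝ E H} {n : WithTop ℕ∞}
    {M : Type*} [TopologicalSpace M] [ChartedSpace H M] [IsManifold I ((⊤ : ℕ∞) : WithTop ℕ∞) M]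
    {g : LorentzianMetric I n M} {tor : TimeOrientation g} {S : Set M} {p : M} :
    p ∈ g.causalPast tor S ↔ ∃ q ∈ S, p ∈ g.causalPast tor {q} := by
  unfold LorentzianMetric.causalPast
  rw [LorentzianMetric.causalFuture_eq_biUnion]
  simp only [mem_iUnion, exists_prop]

section F1

variable {X : Type} [TopologicalSpace X] [ChartedSpace E3 X]
  [IsManifold (𝓡 3) ((⊤ : ℕ∞) : WithTop ℕ∞) X] [ConnectedSpace X]
  {D : InitialDataSet (𝓡 3) X}

/-- **Late points of the exterior region lie outside every painted horizon.** See the module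
docstring. The hypotheses are: injectivity of the lab chart on the late region, the exhaustion
clause of the crux antecedent (verbatim), and lab-time causality after `τ₁` (clause `H_time′` of
the reshaped stub, with its witness `τ₁`). [folklore] -/
theorem painted_exterior_of_mem_exterior' (𝒟 : VacuumCauchyDevelopment D) {N : ℕ}
    (M a : Fin N → ℝ) (Λ : Fin N → ℝ → lorentzGroup) (ξ : Fin N → ℝ → E3) (τ₀ τ₁ : ℝ)
    (U : Opens E4) (Φ : U → 𝒟.carrier) (O : Set 𝒟.carrier)
    (hinj : InjOn Φ {x : U | τ₀ < x.1 0})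
    (hexh : ∀ t₁ : ℝ, τ₀ < t₁ → O \ Φ '' {x : U | t₁ < x.1 0 ∧ ∀ i, Kerr.rPlus (M i) (a i) <
      Kerr.radius (a i) (poincareInv (Λ i (x.1 0)) (E4.ofTimeSpace (x.1 0) (ξ i (x.1 0))) x.1)} ⊆
      𝒟.metric.causalPast 𝒟.timeOrientation (Φ '' {x : U | x.1 0 = t₁ ∧ ∀ i,
        Kerr.rPlus (M i) (a i) < Kerr.radius (a i) (poincareInv (Λ i (x.1 0))
          (E4.ofTimeSpace (x.1 0) (ξ i (x.1 0))) x.1)}))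
    (htime : ∀ x y : U, τ₁ < x.1 0 → τ₁ < y.1 0 →
      Φ y ∈ 𝒟.metric.causalFuture 𝒟.timeOrientation {Φ x} → x.1 0 ≤ y.1 0)
    (x : U) (hx₀ : τ₀ < x.1 0) (hx₁ : τ₁ < x.1 0) (hxO : Φ x ∈ O) (i : Fin N) :
    Kerr.rPlus (M i) (a i) <
      Kerr.radius (a i) (poincareInv (Λ i (x.1 0)) (E4.ofTimeSpace (x.1 0) (ξ i (x.1 0))) x.1) := by
  by_contra hcon
  -- an intermediate lab time `t'`
  set t' : ℝ := (max τ₀ τ₁ + x.1 0) / 2 with ht'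
  have hmax : max τ₀ τ₁ < x.1 0 := max_lt hx₀ hx₁
  have ht'₀ : τ₀ < t' := by rw [ht']; linarith [le_max_left τ₀ τ₁]
  have ht'₁ : τ₁ < t' := by rw [ht']; linarith [le_max_right τ₀ τ₁]
  have ht'x : t' < x.1 0 := by rw [ht']; linarith
  -- `Φ x` is not in the image of the painted exterior after `t'`
  have hnot : Φ x ∉ Φ '' {y : U | t' < y.1 0 ∧ ∀ j, Kerr.rPlus (M j) (a j) <
      Kerr.radius (a j) (poincareInv (Λ j (y.1 0)) (E4.ofTimeSpace (y.1 0) (ξ j (y.1 0))) y.1)} := by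
    rintro ⟨y, hy, hyx⟩
    have hyl : τ₀ < y.1 0 := ht'₀.trans hy.1
    have hxy : y = x := hinj hyl hx₀ hyx
    subst hxy
    exact hcon (hy.2 i)
  -- hence it lies in the causal past of the lab slab at `t'`
  obtain ⟨q, ⟨y, hy, rfl⟩, hq⟩ := mem_causalPast_iff_exists.mp (hexh t' ht'₀ ⟨hxO, hnot⟩)
  have hfut : Φ y ∈ 𝒟.metric.causalFuture 𝒟.timeOrientation {Φ x} :=
    LorentzianMetric.mem_causalPast_singleton_iff.mp hq
  have hy₁ : τ₁ < y.1 0 := by rw [hy.1]; exact ht'₁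
  have hle := htime x y hx₁ hy₁ hfut
  rw [hy.1] at hle
  linarith

/-- **The late charted part of the exterior region is the late painted exterior**: with
`T = max τ₀ τ₁`, `O ∩ Φ({x⁰ > T}) ⊆ Φ({x⁰ > T, ∀ i, r₊ᵢ < painted rᵢ})`. [folklore] -/
theorem exterior_inter_image_subset (𝒟 : VacuumCauchyDevelopment D) {N : ℕ}
    (M a : Fin N → ℝ) (Λ : Fin N → ℝ → lorentzGroup) (ξ : Fin N → ℝ → E3) (τ₀ τ₁ : ℝ)
    (U : Opens E4) (Φ : U → 𝒟.carrier) (O : Set 𝒟.carrier)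
    (hinj : InjOn Φ {x : U | τ₀ < x.1 0})
    (hexh : ∀ t₁ : ℝ, τ₀ < t₁ → O \ Φ '' {x : U | t₁ < x.1 0 ∧ ∀ i, Kerr.rPlus (M i) (a i) <
      Kerr.radius (a i) (poincareInv (Λ i (x.1 0)) (E4.ofTimeSpace (x.1 0) (ξ i (x.1 0))) x.1)} ⊆
      𝒟.metric.causalPast 𝒟.timeOrientation (Φ '' {x : U | x.1 0 = t₁ ∧ ∀ i,
        Kerr.rPlus (M i) (a i) < Kerr.radius (a i) (poincareInv (Λ i (x.1 0))
          (E4.ofTimeSpace (x.1 0) (ξ i (x.1 0))) x.1)}))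
    (htime : ∀ x y : U, τ₁ < x.1 0 → τ₁ < y.1 0 →
      Φ y ∈ 𝒟.metric.causalFuture 𝒟.timeOrientation {Φ x} → x.1 0 ≤ y.1 0) :
    O ∩ Φ '' {x : U | max τ₀ τ₁ < x.1 0} ⊆
      Φ '' {x : U | max τ₀ τ₁ < x.1 0 ∧ ∀ i, Kerr.rPlus (M i) (a i) <
        Kerr.radius (a i) (poincareInv (Λ i (x.1 0)) (E4.ofTimeSpace (x.1 0) (ξ i (x.1 0))) x.1)} := by
  rintro p ⟨hpO, x, hx, rfl⟩
  have hx' : max τ₀ τ₁ < x.1 0 := hx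
  exact ⟨x, ⟨hx', fun i ↦ painted_exterior_of_mem_exterior' 𝒟 M a Λ ξ τ₀ τ₁ U Φ O hinj hexh htime x
    ((le_max_left _ _).trans_lt hx') ((le_max_right _ _).trans_lt hx') hpO i⟩, rfl⟩

end F1

/-- Registered sub-goal form (stub `painted_exterior_of_mem_exterior` of the crux item) of
`painted_exterior_of_mem_exterior'`. [folklore] -/
theorem painted_exterior_of_mem_exterior : open Literature.Geometry.Lorentzian Set Manifold in ∀ {X : Type} [TopologicalSpace X] [ChartedSpace E3 X] [IsManifold (𝓡 3) ((⊤ : ℕ∞) : WithTop ℕ∞) X] [ConnectedSpace X] {D : InitialDataSet (𝓡 3) X} (𝒟 : VacuumCauchyDevelopment D) {N : ℕ} (M a : Fin N → ℝ) (Λ : Fin N → ℝ → lorentzGroup) (ξ : Fin N → ℝ → E3) (τ₀ τ₁ : ℝ) (U : TopologicalSpace.Opens E4) (Φ : U → 𝒟.carrier) (O : Set 𝒟.carrier), InjOn Φ {x : U | τ₀ < x.1 0} → (∀ t₁ : ℝ, τ₀ < t₁ → O \ Φ '' {x : U | t₁ < x.1 0 ∧ ∀ i, Kerr.rPlus (M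 i) (a i) < Kerr.radius (a i) (poincareInv (Λ i (x.1 0)) (E4.ofTimeSpace (x.1 0) (ξ i (x.1 0))) x.1)} ⊆ 𝒟.metric.causalPast 𝒟.timeOrientation (Φ '' {x : U | x.1 0 = t₁ ∧ ∀ i, Kerr.rPlus (M i) (a i) < Kerr.radius (a i) (poincareInv (Λ i (x.1 0)) (E4.ofTimeSpace (x.1 0) (ξ i (x.1 0))) x.1)})) → (∀ x y : U, τ₁ < x.1 0 → τ₁ < y.1 0 → Φ y ∈ 𝒟.metric.causalFuture 𝒟.timeOrientation {Φ x} → x.1 0 ≤ y.1 0) → ∀ x : U, τ₀ < x.1 0 → τ₁ < x.1 0 → Φ x ∈ O → ∀ i : Fin N, Kerr.rPlus (M i) (a i) < Kerr.radius (a i) (poincareInv (Λ i (x.1 0)) (E4.ofTimeSpace (x.1 0) (ξ i (x.1 0))) x.1) :=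
  fun 𝒟 ↦ painted_exterior_of_mem_exterior' 𝒟

end Summit.FinalStateConjecture.FinalStateConjecture.Theorems.SublinearIsFree.Rechart

end
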